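import Mathlib.Combinatorics.Nullstellensatz
import Mathlib.Algebra.MvPolynomial.Monad
import Mathlib.Algebra.MvPolynomial.Equiv
import Mathlib.Data.Fintype.Pi
import Literature.Barriers.ValiantsHypothesis.AlgebraicNaturalProofsGenerators
import HarnessLib

/-!
# FSV18 §1.5 / §3 — Universal constructions of pseudorandom polynomials
# (Forbes–Shpilka–Volk 2018: Thm. 12, Lemmas 13–14, Cor. 15; Meta-Conjecture 8)

Cell `val-lit`, typer t18 (DAG row `FSV18-A`); source texts `paper:arxiv-1701.05328` (corpus
chunks `pNNNN.txt:Lnn`, SEQUENTIAL numbering "Thm. 12", the numbering used by the tree's existing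
`[cite: ForbesShpilkaVolk2018, …]` tags) and `paper:doi-10-4086-toc-2018-v014a018` (the bib key's
published version, Theory of Computing 14(18) 2018, numbered WITHIN SECTIONS, real page numbers);
bib `ForbesShpilkaVolk2018`. Honest framing: typed literature; `VP ≠ VNP` is NOT proved and
nothing here is progress on it.

**Numbering concordance used below** (seq. = arXiv/corpus text; ToC = journal): Meta-Conj. 8 =
ToC 1.9 (p. 14) · Thm. 12 = ToC Thm. 3.1 (p. 19, credited there to Bürgisser [22, §5.6] AND Raz
[81]) · Lemma 13 = ToC Lemma 3.2 (p. 19) · Lemma 14 = ToC Lemma 3.3 (p. 19) · Cor. 15 = ToC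
Cor. 3.4 (p. 20).

**What the tree already has (CITED, not restated).** FSV Def. 1 / Def. 3 / Thm. 4 / Cor. 5 /
Question 6 / Def. 7 and Lemma 14 in its infinite-field form are
`Literature.Barriers.ValiantsHypothesis.{coeffVector, IsNaturalProof, IsSuccinctHittingSet,
exists_isNaturalProof_iff, degLEMonomials, SmallCircuits, Distinguishers, SuccinctHittingSetsForVP,
genOutput, IsHittingSetGenerator, IsSuccinctGenerator, isSuccinctHittingSet_of_generator,
SuccinctGeneratorsForVP, succinctHittingSetsForVP_of_generators}` (files
`AlgebraicNaturalProofs.lean`, `AlgebraicNaturalProofsGenerators.lean`). Raz's universal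
circuit-graph (the homogeneous core of Thm. 12) is `Literature.Computability.AlgebraicComplexity.RazUniversal.*`
(`RazUniversalCircuits.lean`: `out`, `uCoeff`, `exists_labels_of_complexity_le`, `card_lab_le`).
ROUTE-SIDE (namespace `Summit.…`, not importable here): Lemma 13 / the informal Thm. 1.8 in the
tree's regime `d = n` over `ℂ` is PROVED as
`Summit.ValiantsHypothesis.ValiantsHypothesis.Theorems.BarrierLever.SuccinctHittingSetsForVP.Generator.exists_generator`
and `….succinctHittingSetsForVP_iff_generator` (`BarrierLeverSuccinctHittingSetsForVPGeneratorEquivalence.lean`).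

**What this file adds.**
* `FSV2018_thm12` — NAMED FACT, Thm. 12 as printed (universal circuit `U(x, y)` of size
  `poly(n,d,s)` with `deg_x U ≤ d`, `deg_y U ≤ poly(d)`, covering every degree-`≤ d` size-`≤ s`
  polynomial), in the tree's size measure `complexity`; the printed uniformity clause ("`U` can be
  constructed in time `poly(n,d,s)`") has no counterpart in the tree's vocabulary and is DROPPED
  (the fact is weaker than print, never stronger).
* `IsSuccinctHittingSet.isHittingSetGenerator_of_covers` — PROVED, the logical core of Lemma 13
  (any commutative semiring): a polynomial map whose outputs include the coefficient vectors of a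
  hitting set is a hitting-set generator.
* `FSV2018_lemma13` — NAMED FACT, Lemma 13 as printed (`s`-succinct hitting set ⇒
  `poly(n,d,s)`-succinct generator computable in size `poly(n,d,s)`), general degree `d`.
* `FSV2018.exists_finset_hittingSet_of_generator` — PROVED, Lemma 14 in its printed COUNTING form:
  over a field with more than `δΔ` elements, a `𝒞`-succinct generator on `ℓ` seed variables of
  degree `≤ δ` for a class `𝒟` of degree-`≤ Δ` distinguishers yields a hitting set of at most
  `(δΔ+1)^ℓ` members of `𝒞` (interpolation = Mathlib's `MvPolynomial.eq_zero_of_eval_zero_at_prod_finset`).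
* `FSV2018_cor15` — NAMED FACT, Cor. 15 in the tree's regime (`d = n`, `N = binom(2n,n)`,
  classes `SmallCircuits` / `Distinguishers`): succinct hitting sets for `VP` at level `a` imply
  FINITE SUCCINCT hitting sets of quasi-polynomial size `2^(n^c)` (= `poly(N)^{polylog N}` since
  `2^n ≤ N ≤ 4^n`) for the level-`a` distinguishers ("explicit" rendered as succinct-and-small,
  which is what the printed construction `G(x, S^ℓ)` is; bare existence of small hitting sets
  would be content-free by Heintz–Schnorr); stated over an infinite field as the tree's hypothesis
  `SuccinctHittingSetsForVP` is (print: "Let 𝔽 be a field"; the proof via Lemma 14 needs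
  `|𝔽| > δΔ`).
* Meta-Conjecture 8 (ToC 1.9) is NOT a mathematical statement ("for any restricted class … for
  which explicit constructions of subexponential-size hitting sets are CURRENTLY KNOWN …") and is
  recorded in this docstring only; Thm. 9 / Thm. 10 / Cor. 11 (ToC 1.10–1.12), which quantify over
  the circuit models of §§4–7, are typed with those models in
  `Literature/Computability/AlgebraicComplexity/FSV18SuccinctGenerators.lean`.

## References

* [ForbesShpilkaVolk2018] M. A. Forbes, A. Shpilka, B. L. Volk, *Succinct hitting sets and
  barriers to proving lower bounds for algebraic circuits*, Theory Comput. 14 (2018) 18:1–45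
  (STOC 2017; arXiv:1701.05328): Meta-Conj. 8 (ToC 1.9), Thm. 12 (ToC 3.1), Lemma 13 (ToC 3.2),
  Lemma 14 (ToC 3.3), Cor. 15 (ToC 3.4).
* [Raz2010] R. Raz, *Elusive functions and lower bounds for arithmetic circuits*, Theory Comput. 6
  (2010) 135–177, Prop. 2.8, §3 (the universal circuit behind Thm. 12).
-/

noncomputable section

namespace Literature.Barriers.ValiantsHypothesis

open Literature.Computability.AlgebraicComplexity MvPolynomial

/-! ### Thm. 12 (ToC Thm. 3.1): the universal circuit — named fact -/

/-- **FSV Thm. 12 (ToC Thm. 3.1; Bürgisser 2000 §5.6, Raz 2010), universal circuit — NAMED FACT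
(published theorem, not yet assembled in the tree in this inhomogeneous, general-field form).**
Printed: "Let `𝔽` be a field, and let `n, s ≥ 1` and `d ≥ 0`. Then there is a `poly(n,d,s)`-size
algebraic circuit `U ∈ 𝔽[x_1,…,x_n,y_1,…,y_r]` with `r ≤ poly(n,d,s)` such that `U` can be
constructed in time `poly(n,d,s)`, and • `deg_x U(x,y) ≤ d` • `deg_y U(x,y) ≤ poly(d)` • If
`f ∈ 𝔽[x]` has `deg_x f ≤ d` and `f` is computed by a size `s` circuit, then there is some
`α ∈ 𝔽^r` such that `f(x) = U(x,α)`." Rendering: ONE exponent `c` uniform in the field and in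
`n, s, d` (`poly(n,d,s) = (n+d+s)^c`, `poly(d) = (d+2)^c`); variables `x = Sum.inl`, `y = Sum.inr`;
size = the tree's fan-in-two `complexity`; `deg_x`/`deg_y` = degree of every monomial of `U` in the
`x`- resp. `y`-variables; `U(x,α) = aeval (Sum.elim X (C ∘ α)) U`. The clause "`U` can be constructed in
time `poly(n,d,s)`" (uniformity) is not expressible over `complexity` and is dropped. Homogeneous
core in tree: `RazUniversal.exists_labels_of_complexity_le`, `RazUniversal.card_lab_le`; the
`d = n`, `𝔽 = ℂ` instance with explicit constants is proved route-side
(`…BarrierLever.SuccinctHittingSetsForVP.Generator.exists_generator`).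
[cite: ForbesShpilkaVolk2018, Thm. 12 (seq.) = ToC Thm. 3.1, p. 19]
locator: paper:arxiv-1701.05328 p0014.txt:L9; paper:doi-10-4086-toc-2018-v014a018 p0019.txt:L7 -/
def FSV2018_thm12 : Prop :=
  ∃ c : ℕ, ∀ (F : Type) [Field F] (n s d : ℕ), 1 ≤ n → 1 ≤ s →
    ∃ (r : ℕ) (U : MvPolynomial (Fin n ⊕ Fin r) F),
      r ≤ (n + d + s) ^ c ∧
      complexity U ≤ (n + d + s) ^ c ∧
      (∀ e ∈ U.support, ∑ i : Fin n, e (Sum.inl i) ≤ d) ∧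
      (∀ e ∈ U.support, ∑ j : Fin r, e (Sum.inr j) ≤ (d + 2) ^ c) ∧
      ∀ f : MvPolynomial (Fin n) F, f.totalDegree ≤ d → complexity f ≤ s →
        ∃ α : Fin r → F, aeval (Sum.elim X fun j => C (α j)) U = f

/-! ### Lemma 13 (ToC Lemma 3.2): succinct hitting sets give succinct generators -/

section Lemma13

variable {F : Type*} [CommSemiring F] {σ τ : Type*} {M : Set (σ →₀ ℕ)}

/-- **The logical core of FSV Lemma 13 (PROVED, any commutative semiring).** If the coefficient
vector of every member of `𝒞` is an output of the polynomial map `G` ("`𝒞 ⊆ U(x, 𝔽^r)`") and `𝒞`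
is a (`𝒞`-succinct) hitting set for `𝒟`, then `G` is a hitting-set generator for `𝒟` ("we see that
`U` is indeed a generator for `𝒟` as it contains the hitting set `𝒞` in its image"). The converse
half of the remark after Def. 7 (`IsHittingSetGenerator.of_hits`) does the work.
[cite: ForbesShpilkaVolk2018, Lemma 13 (seq.) = ToC Lemma 3.2, p. 19 (proof)]
locator: paper:arxiv-1701.05328 p0014.txt:L22; paper:doi-10-4086-toc-2018-v014a018 p0019.txt:L24 -/
theorem IsSuccinctHittingSet.isHittingSetGenerator_of_covers {𝒞 : Set (MvPolynomial σ F)}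
    {𝒟 : Set (MvPolynomial M F)} {G : M → MvPolynomial τ F} (hhit : IsSuccinctHittingSet M 𝒞 𝒟)
    (hcov : ∀ f ∈ 𝒞, ∃ a : τ → F, genOutput G a = coeffVector M f) :
    IsHittingSetGenerator 𝒟 G := by
  refine IsHittingSetGenerator.of_hits fun D hD hD0 => ?_
  obtain ⟨f, hf, hne⟩ := hhit D hD hD0
  obtain ⟨a, ha⟩ := hcov f hf
  exact ⟨a, by rwa [ha]⟩

end Lemma13

/-- **FSV Lemma 13 (ToC Lemma 3.2) as printed — NAMED FACT.** "Let `𝔽` be a field, and let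
`n, s ≥ 1` and `d ≥ 0`. Let `𝒟 ⊆ 𝔽[c_1,…,c_{N_{n,d}}]` be a class of polynomials in the
coefficient vectors of `𝔽[x_1,…,x_n]^{≤ d}`. If there is an `s`-succinct hitting set for `𝒟` then
there is a `poly(n,d,s)`-succinct generator for `𝒟` computable by `poly(n,d,s)`-size circuits."
Rendering (FSV Def. 3 / Def. 7 in the tree's vocabulary): monomial set `{m : deg m ≤ d}`, simple
class "size-`s` polynomials of degree `≤ d`" = `{f : totalDegree f ≤ d ∧ complexity f ≤ s}`
(`= SmallCircuits F n b` at `d = n`, `s = n^b`); conclusion: a map `G` on `r ≤ poly(n,d,s)` seed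
variables that is a hitting-set generator for `𝒟` (`IsHittingSetGenerator`, Def. 7 (3)), is
`{deg ≤ d, size ≤ poly(n,d,s)}`-succinct (`IsSuccinctGenerator`, Def. 7 (2)), and is "computable
by `poly(n,d,s)`-size circuits" (Def. 7 (1)): `G = coeff_x(U)` for a polynomial `U(x,y)` with
`complexity U ≤ poly(n,d,s)` (`coeff_x` via Mathlib's `sumAlgEquiv`, `(𝔽[y])[x]`). One uniform
exponent `c`. In print this is Thm. 12 + `isHittingSetGenerator_of_covers`; the tree-regime
instance over `ℂ` is proved route-side (`…Generator.exists_generator`).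
[cite: ForbesShpilkaVolk2018, Lemma 13 (seq.) = ToC Lemma 3.2, p. 19]
locator: paper:arxiv-1701.05328 p0014.txt:L22; paper:doi-10-4086-toc-2018-v014a018 p0019.txt:L24 -/
def FSV2018_lemma13 : Prop :=
  ∃ c : ℕ, ∀ (F : Type) [Field F] (n s d : ℕ), 1 ≤ n → 1 ≤ s →
    ∀ 𝒟 : Set (MvPolynomial {m : Fin n →₀ ℕ | m.degree ≤ d} F),
      IsSuccinctHittingSet {m : Fin n →₀ ℕ | m.degree ≤ d}
          {f : MvPolynomial (Fin n) F | f.totalDegree ≤ d ∧ complexity f ≤ s} 𝒟 →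
        ∃ (r : ℕ) (G : {m : Fin n →₀ ℕ | m.degree ≤ d} → MvPolynomial (Fin r) F),
          r ≤ (n + d + s) ^ c ∧
          IsHittingSetGenerator 𝒟 G ∧
          IsSuccinctGenerator {m : Fin n →₀ ℕ | m.degree ≤ d}
            {f : MvPolynomial (Fin n) F | f.totalDegree ≤ d ∧ complexity f ≤ (n + d + s) ^ c} G ∧
          ∃ U : MvPolynomial (Fin n ⊕ Fin r) F, complexity U ≤ (n + d + s) ^ c ∧
            ∀ m, G m = coeff (m : Fin n →₀ ℕ) (sumAlgEquiv F (Fin n) (Fin r) U)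

/-! ### Lemma 14 (ToC Lemma 3.3), counting form: generators give SMALL succinct hitting sets -/

namespace FSV2018

variable {F : Type*} [Field F] {σ : Type*} {M : Set (σ →₀ ℕ)}

/-- Degree of a substitution: if every `θ i` has total degree `≤ δ` then `g(θ)` has total degree
`≤ (deg g) · δ` ("`deg_y D(coeff_x G(x,y)) ≤ deg D · deg_y G`", the first line of the proof of
Lemma 14). [cite: ForbesShpilkaVolk2018, Lemma 14 (seq.) = ToC Lemma 3.3, p. 19–20 (proof)]
locator: paper:doi-10-4086-toc-2018-v014a018 p0020.txt:L2 -/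
theorem totalDegree_bind₁_le_mul {R : Type*} [CommSemiring R] {ι κ : Type*}
    (θ : ι → MvPolynomial κ R) (δ : ℕ) (hθ : ∀ i, (θ i).totalDegree ≤ δ) (g : MvPolynomial ι R) :
    (bind₁ θ g).totalDegree ≤ g.totalDegree * δ := by
  classical
  conv_lhs => rw [g.as_sum]
  rw [map_sum]
  refine (totalDegree_finsetSum _ _).trans (Finset.sup_le fun m hm => ?_)
  rw [bind₁_monomial]
  refine (totalDegree_mul _ _).trans ?_
  rw [totalDegree_C, zero_add]
  refine (totalDegree_finsetProd _ _).trans ?_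
  calc ∑ i ∈ m.support, (θ i ^ m i).totalDegree
      ≤ ∑ i ∈ m.support, m i * δ :=
        Finset.sum_le_sum fun i _ => (totalDegree_pow _ _).trans (Nat.mul_le_mul_left _ (hθ i))
    _ = (m.sum fun _ e => e) * δ := by rw [Finsupp.sum, Finset.sum_mul]
    _ ≤ g.totalDegree * δ := Nat.mul_le_mul_right _ (le_totalDegree hm)

/-- Interpolation step of Lemma 14 (PROVED): a nonzero polynomial in `ℓ` variables of total degree
`≤ δΔ` does not vanish on the grid `S^ℓ` when `|S| ≥ δΔ + 1` ("as the field is large enough we can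
find a set `S ⊆ 𝔽` with `|S| ≥ δΔ+1`, so that by interpolation …"; here Mathlib's
`MvPolynomial.eq_zero_of_eval_zero_at_prod_finset`).
[cite: ForbesShpilkaVolk2018, Lemma 14 (seq.) = ToC Lemma 3.3, p. 20 (proof)]
locator: paper:doi-10-4086-toc-2018-v014a018 p0020.txt:L3 -/
theorem exists_eval_ne_zero_of_totalDegree_lt {ℓ : ℕ} {Q : MvPolynomial (Fin ℓ) F} (hQ : Q ≠ 0)
    (S : Finset F) (hS : Q.totalDegree < S.card) :
    ∃ a : Fin ℓ → F, (∀ i, a i ∈ S) ∧ eval a Q ≠ 0 := by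
  by_contra hcon
  push Not at hcon
  refine hQ (eq_zero_of_eval_zero_at_prod_finset Q (fun _ => S) (fun i => ?_) ?_)
  · exact (degreeOf_le_totalDegree Q i).trans_lt hS
  · intro x hx
    exact hcon x hx

/-- **FSV Lemma 14 (ToC Lemma 3.3), counting form (PROVED).** Printed: "Let `𝔽` be a field with
`|𝔽| > δΔ`, where `Δ, δ ≥ 0`. … Let `𝒟 ⊆ 𝔽[c_1,…,c_{N_{n,d}}]` be a class of degree-`Δ`
polynomials in the coefficient vectors of `𝔽[x]^{≤ d}`. Suppose that `G ∈ 𝔽[x,y_1,…,y_ℓ]` is a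
succinct generator computable in size-`s` for `𝒟` where `deg_y G ≤ δ`. Then there is a
`s`-succinct hitting set of size `(δΔ+1)^ℓ`." Rendering: the generator is a polynomial map `G` on
`ℓ` seed variables with every coordinate of degree `≤ δ` (`deg_y G ≤ δ`), a hitting-set generator
for `𝒟` (Def. 7 (3)) whose outputs are coefficient vectors of members of `𝒞`
(`IsSuccinctGenerator`, Def. 7 (2); "computable in size-`s`" enters only through `𝒞` = the size-`s`
class, so `𝒞` is kept abstract and the monomial set `M` arbitrary); `|𝔽| > δΔ` = a finite
`S ⊆ 𝔽` with `δΔ + 1 ≤ |S|`; conclusion: a finite `H ⊆ 𝒞`, `|H| ≤ (δΔ+1)^ℓ`, that is a hitting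
set for `𝒟` (FSV Def. 3, `IsSuccinctHittingSet M H 𝒟`). The infinite-field, size-free form is the
tree's `isSuccinctHittingSet_of_generator`.
[cite: ForbesShpilkaVolk2018, Lemma 14 (seq.) = ToC Lemma 3.3, p. 19–20]
locator: paper:arxiv-1701.05328 p0014.txt:L36; paper:doi-10-4086-toc-2018-v014a018 p0019.txt:L38 -/
theorem exists_finset_hittingSet_of_generator {ℓ δ Δ : ℕ} {𝒞 : Set (MvPolynomial σ F)}
    {𝒟 : Set (MvPolynomial M F)} {G : M → MvPolynomial (Fin ℓ) F}
    (hΔ : ∀ D ∈ 𝒟, D.totalDegree ≤ Δ) (hδ : ∀ m, (G m).totalDegree ≤ δ)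
    (hgen : IsHittingSetGenerator 𝒟 G) (hsucc : IsSuccinctGenerator M 𝒞 G)
    (S : Finset F) (hS : δ * Δ + 1 ≤ S.card) :
    ∃ H : Finset (MvPolynomial σ F), ↑H ⊆ 𝒞 ∧ H.card ≤ (δ * Δ + 1) ^ ℓ ∧
      IsSuccinctHittingSet M (↑H : Set (MvPolynomial σ F)) 𝒟 := by
  classical
  -- a subset `S₀ ⊆ S` of exactly `δΔ + 1` interpolation points
  obtain ⟨S₀, hS₀S, hS₀⟩ := Finset.exists_subset_card_eq hS
  -- the seeds on the grid `S₀^ℓ`, and for each seed a member of `𝒞` realising the output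
  choose f hf𝒞 hfout using hsucc
  let seeds : Finset (Fin ℓ → F) := Fintype.piFinset fun _ => S₀
  refine ⟨seeds.image f, ?_, ?_, ?_⟩
  · intro g hg
    obtain ⟨a, -, rfl⟩ := Finset.mem_image.1 (Finset.mem_coe.1 hg)
    exact hf𝒞 a
  · calc (seeds.image f).card ≤ seeds.card := Finset.card_image_le
      _ = (δ * Δ + 1) ^ ℓ := by
          rw [Fintype.card_piFinset, Finset.prod_const, Finset.card_univ, Fintype.card_fin, hS₀]
  · intro D hD hD0
    have hcomp : bind₁ G D ≠ 0 := hgen D hD hD0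
    have hdeg : (bind₁ G D).totalDegree < S₀.card := by
      rw [hS₀]
      have := totalDegree_bind₁_le_mul G δ hδ D
      have hD' := hΔ D hD
      calc (bind₁ G D).totalDegree ≤ D.totalDegree * δ := this
        _ ≤ Δ * δ := Nat.mul_le_mul_right _ hD'
        _ = δ * Δ := Nat.mul_comm _ _
        _ < δ * Δ + 1 := Nat.lt_succ_self _
    obtain ⟨a, haS, hne⟩ := exists_eval_ne_zero_of_totalDegree_lt hcomp S₀ hdeg
    refine ⟨f a, ?_, ?_⟩
    · exact Finset.mem_coe.2 (Finset.mem_image.2 ⟨a, Fintype.mem_piFinset.2 haS, rfl⟩)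
    · rw [hfout a, ← eval_bind₁_eq_eval_genOutput]
      exact hne

end FSV2018

/-! ### Cor. 15 (ToC Cor. 3.4): any succinct hitting set gives explicit quasi-polynomial hitting sets -/

/-- **FSV Cor. 15 (ToC Cor. 3.4) — NAMED FACT in the tree's regime.** Printed: "Let `𝔽` be a
field, and let `n ≥ 1`. Consider polynomials in `𝔽[c_1,…,c_N]` where `N = binom(2n, n)` so that
`𝔽[c_1,…,c_N]` can be identified with the coefficients of polynomials in `𝔽[x_1,…,x_n]^{≤ d}` with
`d = n`. If `poly(N)`-size `poly(N)`-degree circuits in `𝔽[c_1,…,c_N]` have `poly(n)`-succinct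
hitting sets from `𝔽[x]^{≤ n}`, then such circuits have an explicit `poly(N)^{polylog N}`-size
hitting set." (Text before it: "any (even infinite) succinct hitting set implies
quasipolynomial-size hitting sets"; its proof = Lemma 13 + Lemma 14, whose hitting set
`G(x, S^ℓ)` consists of coefficient vectors of size-`poly(n)` polynomials AND has
`(δΔ+1)^ℓ = 2^{poly(n)}` elements.) Rendering over the tree's classes (exactly the regime `d = n`,
`N = binom(2n,n)` of `degLEMonomials` / `SmallCircuits F n b` / `Distinguishers F n a`): for every
distinguisher level `a`, IF some size exponent `b` makes `SmallCircuits F n b` a succinct hitting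
set for `Distinguishers F n a` for all large `n` (the level-`a` instance of
`SuccinctHittingSetsForVP F`), THEN for some `b', c` and all large `n` there is a FINITE set `H` of
at most `2^(n^c)` polynomials, all in `SmallCircuits F n b'`, whose coefficient vectors hit every
nonzero member of `Distinguishers F n a` — `poly(N)^{polylog N} = 2^{polylog N}` and
`2^n ≤ N ≤ 4^n`, so `2^{poly(n)}` is the printed size bound. "Explicit" (poly-time constructible)
is not expressible in the tree's vocabulary; it is rendered by what the printed construction
delivers and what carries the content: the small hitting set is itself SUCCINCT (`H ⊆ SmallCircuits
F n b'`). (Without the succinctness clause, hitting sets of size `poly(N^a) = 2^{O(a n)}` for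
`Distinguishers F n a` exist unconditionally over infinite fields by Heintz–Schnorr counting, so a
bare existence statement would be content-free.) Infinite field, as in the tree's
`SuccinctHittingSetsForVP` (print: "a field"; Lemma 14 needs `|𝔽| > δΔ`).
[cite: ForbesShpilkaVolk2018, Cor. 15 (seq.) = ToC Cor. 3.4, p. 20]
locator: paper:arxiv-1701.05328 p0015.txt:L7; paper:doi-10-4086-toc-2018-v014a018 p0020.txt:L10 -/
def FSV2018_cor15 : Prop :=
  ∀ (F : Type) [Field F] [Infinite F] (a : ℕ),
    (∃ b n₀ : ℕ, ∀ n : ℕ, n₀ ≤ n →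
      IsSuccinctHittingSet (degLEMonomials n) (SmallCircuits F n b) (Distinguishers F n a)) →
    ∃ b' c n₀ : ℕ, ∀ n : ℕ, n₀ ≤ n →
      ∃ H : Finset (MvPolynomial (Fin n) F), (↑H : Set (MvPolynomial (Fin n) F)) ⊆ SmallCircuits F n b' ∧
        H.card ≤ 2 ^ (n ^ c) ∧
        IsSuccinctHittingSet (degLEMonomials n) (↑H : Set (MvPolynomial (Fin n) F)) (Distinguishers F n a)

/-- Under the tree's hypothesis `SuccinctHittingSetsForVP F` (FSV Question 6 answered "yes"), the
fact `FSV2018_cor15` delivers, for EVERY distinguisher level, finite succinct hitting sets of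
quasi-polynomial size ("any (even infinite) succinct hitting set implies quasipolynomial-size
hitting sets"). [cite: ForbesShpilkaVolk2018, Cor. 15 (seq.) = ToC Cor. 3.4, p. 20]
locator: paper:doi-10-4086-toc-2018-v014a018 p0020.txt:L7 -/
theorem FSV2018_cor15.of_succinctHittingSetsForVP (h : FSV2018_cor15) (F : Type) [Field F]
    [Infinite F] (hyp : SuccinctHittingSetsForVP F) (a : ℕ) :
    ∃ b' c n₀ : ℕ, ∀ n : ℕ, n₀ ≤ n →
      ∃ H : Finset (MvPolynomial (Fin n) F), (↑H : Set (MvPolynomial (Fin n) F)) ⊆ SmallCircuits F n b' ∧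
        H.card ≤ 2 ^ (n ^ c) ∧
        IsSuccinctHittingSet (degLEMonomials n) (↑H : Set (MvPolynomial (Fin n) F)) (Distinguishers F n a) :=
  h F a (hyp a)

end Literature.Barriers.ValiantsHypothesis

end
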